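import Summits.SmoothPoincare4.SmoothPoincare4.Theses.ZeroSurgeryExotic
import Literature.Uncategorized.Crux
import Summits.SmoothPoincare4.SmoothPoincare4.Theorems.ZseCruxRasmussen.Negative.Parity
import Literature.Topology.FourManifolds.RasmussenConcordanceProofs
import Literature.Topology.FourManifolds.KirbyMoves
import Literature.Topology.FourManifolds.KirbyMovesStrictHandleSlide
import Literature.Topology.FourManifolds.KirbyMovesStrictHandleSlideProofs
import Literature.Topology.FourManifolds.KnotsProofs
import Literature.Topology.FourManifolds.LinkingNumberPushOffInstance
import Literature.Topology.FourManifolds.BandSum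
import Literature.Topology.FourManifolds.SliceGenus
import Literature.Topology.FourManifolds.SliceRibbon
import Literature.Topology.FourManifolds.SliceRibbonTransportProofs
import Literature.Topology.FourManifolds.GaussDiagrams
import Literature.Topology.FourManifolds.LeeRasmussen
import Literature.Topology.FourManifolds.Rasmussen
import Literature.Topology.FourManifolds.HomotopyBallSlice
import Literature.Topology.FourManifolds.DehnSurgery
import Literature.Topology.FourManifolds.DehnSurgeryProofs
import Literature.Topology.FourManifolds.DehnSurgeryTransportProofs

/-!
# Line `forced-profile-inversion` — skeleton for crux `ZseCruxRasmussen` (stmt-SmoothPoincare4-0366)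

Route `ZeroSurgeryExotic` (refutation route against `SmoothPoincare4`), crux #2, idea card
`Cruxes/ZseCruxRasmussen/Ideas/forced-profile-inversion.md` (triage r1: pass ×3), line card
`Cruxes/ZseCruxRasmussen/Lines/forced-profile-inversion.md`.

CRUX (fixed, never restated). The route decl `Theses.ZeroSurgeryExotic.ZseCruxRasmussen` is NOT
materialised in the route file (it sits there as a TODO comment: the route file does not import
`LeeRasmussen`); its ledger signature is carried VERBATIM by the gate-relocated
`Literature.Uncategorized.Crux` (`@[conjecture]`, `Literature/Uncategorized/Crux.lean`), which the
standing disprover's `Disproof.lean` and the landed `Theorems/ZseCruxRasmussen/Negative/Parity.lean`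
also use. The composition below therefore concludes `Literature.Uncategorized.Crux` BY NAME
(`ledger skeleton check … --crux-decl Literature.Uncategorized.Crux`):

  `∃ K K' Y s, IsIntegralSurgery (𝓡 3) Y K 0 ∧ IsIntegralSurgery (𝓡 3) Y K' 0 ∧ K.IsSmoothlySlice ∧
     K'.HasRasmussenInvariant s ∧ s ≠ 0`.

THE LINE. Manolescu–Piccirillo's Lemma 3.3 (PROVED in the tree) makes the non-slice partner `K'`
of every witness slice in a homotopy 4-ball; hence (Freedman) topologically slice, (homology
concordance) `τ = ν = ε = 0`, `Υ ≡ 0`, and (Gabai) of the same Seifert genus / fibredness /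
Alexander module as the slice knot `K`. So `K'` lives in the sparse, seed-side COMPUTABLE locus
`𝔇 = {s_ℚ ≠ 0; τ = ν = ε = 0; topologically slice; …}` — on Dunfield–Gong's census PS19
(prime, ≤ 19 crossings) at most ≈ 78 knots (arXiv:2512.21825 p. 35: 0.04 % of the 195,155
`s`-obstructed knots) BEFORE the HKL and `d`-invariant filters. The line INVERTS the witness search:
enumerate `𝔇 ∩ PS19` first (one Khovanov computation per ≤ 19-crossing seed), then generate
`0`-friends of the few seeds at depth (DG drilled every PS19 knot only with geodesics of length ≤ 3,
§5.1 p. 36) and certify a RIBBON friend by a band certificate (DG §2.10) — the expensive invariant is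
computed once per small seed, the big friend only needs the one-sided, semi-decidable ribbon test.

CERTIFICATE FORMAT (what a found pair must come with, all finite and machine-checkable):
* SEED certificate `IsCertifiedSeed K' D`: a Gauss diagram `D` of `K'` with `D.n ≤ 19` crossings and
  `D.rasmussenInvariant ≠ 0` (the tree's `s` is the ℚ-Lee invariant — triage sharpening "restrict 𝔇
  to `s_ℚ ≠ 0`" is automatic);
* RIBBON certificate `HasFusionCertificate K`: `K` is a fusion of a split unlink along finitely many
  bands (= DG's ribbon certificate `(D₁, b₁, …, b_k, D_{k+1})` read backwards, §2 p. 15, §2.10 p. 23);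
* `0`-FRIEND certificate `HasZeroFriendCertificate K K'`: `(K, 0)` and `(K', 0)` are STRICTLY KIRBY
  EQUIVALENT framed links (the tree's corrected Kirby calculus, `KirbyMovesStrictHandleSlide.lean`);
  by Kirby's theorem (1978, Thm 1, "only if") this format loses no `0`-friend pair, and every RBG link
  (Manolescu–Piccirillo Thm 1.2: all `0`-surgery homeomorphisms arise from RBG links) or annulus
  presentation yields one explicitly (slides + slam-dunks + cancellations).

STUBS (5; registered; `sorry` only inside them):
1. `stub_certifiedPairSupply` — THE BET (hardest; open-problem strength): some certified seed has a
   band-certified ribbon `0`-friend. Sector = seeds with a ≤ 19-crossing diagram (PS19 and smaller).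
2. `stub_commonZeroSurgery_of_zeroFriendCertificate` — Kirby's theorem ("if") + existence + transport:
   a `0`-friend certificate gives a closed smooth 3-manifold that is `0`-surgery on both knots
   (M; theorem-level modulo the tree's one open Kirby leaf (H) `FramedLink.IsStrictHandleSlide.isSurgery`).
3. `stub_isRibbon_of_fusionCertificate` — a fusion of a split unlink is ribbon in the tree's Morse sense
   (L; classical: discs = minima, bands = saddles, no maxima).
4. `stub_genus_eq_of_commonZeroSurgery` — Gabai: knots with a common `0`-surgery have equal Seifert genus
   (L; theorem-level modulo the named fact `hasSeifertSurfaceOfGenus_le_of_isIntegralSurgery_zero` +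
   the capped Seifert surface).
5. `stub_isTopologicallySlice_of_isHomotopyBallSlice` — Freedman: slice in a homotopy ball ⇒ topologically
   slice (XL in Lean; theorem-level: Freedman 1982 Thm 1.6 / FQ §11.7, as used in DG Thm 5.14's proof p. 47).

COMPOSITION `ZseCruxRasmussen_of : Crux` — kernel-checked, no `sorry` of its own: stubs 1 → 2 → 3 and
`HasRasmussenInvariant` read off the seed diagram. THE FORCED PROFILE (sieve soundness, also checked):
`seed_profile` (stubs 2–5 + MP Lemma 3.3: the seed of any certified pair is homotopy-ball slice,
topologically slice and has the genus of its friend) and the KILL FORM of the bet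
`not_certifiedPairSupply_of_sieve` (mod Rasmussen's Thm 1, named fact `eq_zero_of_isSmoothlySlice`):
if EVERY certified seed is excluded by one of the three typed filters — not topologically slice (HKL
tests certify this), not homotopy-ball slice (what `τ/ν/ε/d ≠ 0` certify, informally: no knot Floer
homology in the tree), or `0`-surgery-rigid among knots of its genus (Baldwin–Sivek-type
characterisations; Gabai supplies the genus restriction) — then stub 1 is FALSE. This is how the
seed-side table job kills the line without drawing a single friend.

DISPROOF USED (`Cruxes/ZseCruxRasmussen/Disproof.lean` v3 = cdisprove cycles 1–2, re-read 2026-08-16 by the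
gen-2 planner seat) AND THE LANDED NEGATIVE LEMMAS (exercised in §Checks below; `Negative.Parity` is imported above,
`Negative.Shape`'s olean was not yet built on the farm at publish time — `import Literature…RasmussenConcordanceProofs`
stands in for its Fox–Milnor lemma and its two §3 lemmas used below are inlined verbatim, named in comments; swap in
`import Summits.SmoothPoincare4.SmoothPoincare4.Theorems.ZseCruxRasmussen.Negative.Shape` once served):
`Theorems/ZseCruxRasmussen/Negative/Parity.lean` (p74212: `hasRasmussenInvariant_even`, `crux_iff_two_le_abs`)
and `Theorems/ZseCruxRasmussen/Negative/Shape.lean` (p76009 = Disproof §1–§4 landed: `sWitness_inhabited`,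
`crux_without_slice/_nonzero/_commonSurgery/_surgeryLeft/_surgeryRight`, `crux_false_of_sameKnot/
_concordant/_slicePartner`, `not_crux_of_mmsw911/_zeroSurgeryDeterminesSliceness/_assembly2/_spc4`,
`crux_witness_avoids_gluckTwist`). There are no `_false_without_<H>` theorems by that name for THIS crux
(an existential); Shape §1 `crux_without_*` plays that role — every conjunct is load-bearing — and the
stub set PRODUCES all four conjuncts (common `Y`: stub 2; `K` slice: stub 3; `HasRasmussenInvariant` and
`s ≠ 0`: the seed certificate, by `rfl`). Shape §2 (dead strengthenings, mod Rasmussen Thm 1): honoured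
at certificate level — `friend_ne_seed` (the ribbon friend is never the seed: `crux_false_of_sameKnot`),
`seed_not_isSmoothlySlice` / `not_isConcordant_seed_friend` (`crux_false_of_slicePartner/_of_concordant`),
and filter (iii) of the kill form is the same-knot exclusion used as a seed FILTER. Shape §3 (position):
`not_certifiedPair_of_spc4` / `not_certifiedPair_of_mmsw911` below derive, FROM THE LANDED LEMMAS through
the Transfer `crux_of_certifiedPair`, that stub 1 is false under SPC4 + Rasmussen and under MMSW Q 9.11 —
the bet is priced exactly: a certified pair is a disproof of SPC4, nothing cheaper refutes it than the
seed-side kill form. Shape §4 / Disproof §7 (`crux_witness_avoids_gluckTwist`, `exoticCP2Sum_of_crux`):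
consistent, nothing to honour (no sphere is built; the bet accepts that the MP sphere of a found pair
is not a Gluck twist and is `ℂℙ²`-stably exotic). Disproof §8 `isTopologicallySlice_of_isHomotopyBallSlice`
(the disprover's HYPOTHESIS `hF`) is STUB 5 here, a target. Parity: `two_le_abs_of_isCertifiedSeed` — a
seed certificate may equivalently demand `2 ≤ |D.rasmussenInvariant|`. NO STUB IS AN INSTANCE OF A LANDED
NEGATIVE LEMMA (stubs 2–5 are theorems in print; stub 1 asserts none of the excluded shapes: its pair is a
non-concordant, distinct (K, K') with a COMMON `Y`). The sibling crux's landed files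
`Theorems/ZseSVanishesOnPairs/Negative/{LoadBearing,Position,Strengthenings,Targets}.lean` constrain PROOFS
of `¬ Crux` (must use the smooth disc of `K` and framing `0`), not this line. `killSwitch_open` (= item
0368, the one sorried near-miss of Disproof §5) is what a null run of the table job gives evidence FOR on
the ≤ 19-crossing sector.

GEN-2 RE-CHECK (2026-08-16, planner seat `…-forced-profile-inver-g2-0`): stub names and signatures are
byte-identical to the registered skeleton (sha 81c42ecb8ae7, `ledger skeleton check` 02:29:44Z, 5 active
stubs); this revision only (a) imports the two landed Negative modules, (b) factors the composition
through the explicit Transfer theorem `crux_of_certifiedPair : C⁺ → Crux` (stubs 2–3) with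
`ZseCruxRasmussen_of : Crux := crux_of_certifiedPair stub_certifiedPairSupply`, and (c) adds the
sorry-free §Checks. Audit note for the lead: stubs 4–5 are deliberately NOT on the path to `Crux` (the
audit lists them `orphan` w.r.t. the item) — they are the soundness of the seed SIEVE (`seed_profile`,
`not_certifiedPairSupply_of_sieve`): closing stubs 1–3 closes the crux; stubs 4–5 are what licenses
searching only `𝔇` and what turns an empty seed table into a line-dead certificate.
-/

noncomputable section

set_option linter.dupNamespace false

open scoped Manifold ContDiff
open Literature.Topology.FourManifolds Literature.Uncategorized

namespace Summit.SmoothPoincare4.SmoothPoincare4.Cruxes.ZseCruxRasmussen.ForcedProfileInversion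

/-- Local notation: `𝔼 n` is `EuclideanSpace ℝ (Fin n)`. -/
local notation "𝔼 " n:arg => EuclideanSpace ℝ (Fin n)

/-! ### Certificate formats (definitions over tree declarations only) -/

/-- One FUSION MOVE: the last component `L_{k+1}` of the `(k+2)`-component link `L` is band-summed
INTO the component `L₀` (tree predicate `Knot.IsBandSum`: an embedded band meeting `L₀` exactly in
its left edge, `L_{k+1}` exactly in its right edge, orientations coherent) along a band MISSING the
other components `L₁, …, L_k`, which are carried over unchanged (`L'ⱼ = Lⱼ`, `1 ≤ j ≤ k`); the
result `L'₀` is the band sum. Every fusion tree of an unlink can be realised by such moves (grow the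
tree from the root `0`, absorbing one adjacent original component at a time; index the unlink in the
reverse absorption order; orient each absorbed component to make its band coherent).
[cite: GompfStipsicz1999, §6.2] -/
def IsFusionStep {k : ℕ} (L : Link (Fin (k + 1 + 1))) (L' : Link (Fin (k + 1))) : Prop :=
  Knot.IsBandSum (L.component 0) (L.component (Fin.last (k + 1))) (L'.component 0)
      (⋃ j : Fin k, Set.range (L.component j.succ.castSucc)) ∧
    ∀ j : Fin k, L'.component j.succ = L.component j.succ.castSucc

/-- `K` is obtained from the `(n+1)`-component link `L` by `n` successive fusion moves
(`n = 0`: `K` is the unique component). -/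
def IsFusionOf : (n : ℕ) → Link (Fin (n + 1)) → Knot → Prop
  | 0, L, K => K = L.component 0
  | n + 1, L, K => ∃ L' : Link (Fin (n + 1)), IsFusionStep L L' ∧ IsFusionOf n L' K

/-- **RIBBON (BAND) CERTIFICATE**: `K` is a fusion of a split unlink (`Link.IsSplitUnlink`: the
components bound pairwise disjoint smoothly embedded discs in `S³`) along finitely many bands.
This is Dunfield–Gong's "ribbon certificate" `(D₁, b₁, D₂, …, b_k, D_{k+1})` (a sequence of band
moves from `K` to an unlink) read backwards. [cite: arXiv:2512.21825, §2 p. 15 and §2.10 p. 23] -/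
def HasFusionCertificate (K : Knot) : Prop :=
  ∃ (n : ℕ) (L : Link (Fin (n + 1))), L.IsSplitUnlink ∧ IsFusionOf n L K

/-- **`0`-FRIEND CERTIFICATE**: the `0`-framed knots `(K, 0)` and `(K', 0)` are related by a finite
sequence of STRICT Kirby moves (isotopies, renumberings, reversals, blow-ups/downs of split
`±1`-framed unknots, strict handle slides — through framed links with any number of components):
the tree's corrected Kirby calculus `StrictKirbyEquivalent` (`KirbyMovesStrictHandleSlide.lean`).
By Kirby's theorem ("only if", Kirby 1978 Thm 1) every pair of knots with orientation-preservingly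
diffeomorphic `0`-surgeries admits one, so the format loses no `0`-friend pair; RBG links
(Manolescu–Piccirillo 2023, Thm 1.2) and annulus presentations produce them explicitly.
[cite: Kirby1978, Thm 1] [cite: ManolescuPiccirillo2023, Thm 1.2] -/
def HasZeroFriendCertificate (K K' : Knot) : Prop :=
  StrictKirbyEquivalent ⟨1, FramedLink.single K 0⟩ ⟨1, FramedLink.single K' 0⟩

/-- **SEED CERTIFICATE**: a Gauss diagram `D` of (a regular projection of) `K'` with at most `19`
crossings whose Rasmussen invariant (the tree's ℚ-Lee `GaussDiagram.rasmussenInvariant`) is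
nonzero — one Khovanov/Lee computation on a small diagram. The bound `19` is the extent of the
published census PS19 on which the forced profile is computable today (Dunfield–Gong 2025, §1.8);
raising it is a one-token reshape. [cite: arXiv:2512.21825, §1.8 p. 4 and Table 9 p. 34] -/
def IsCertifiedSeed (K' : Knot) (D : GaussDiagram) : Prop :=
  K'.HasGaussDiagram D ∧ D.n ≤ 19 ∧ D.rasmussenInvariant ≠ 0

/-! ### The five registered stubs (`sorry` lives only here) -/

/-- **STUB 1 — THE BET (hardest; open-problem strength; the search target of the line).** Some knot
`K'` with a ≤ 19-crossing diagram of nonzero `s_ℚ` has a `0`-friend `K` that is a fusion of a split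
unlink, with explicit certificates. K′-FIRST SEARCH PLAN (line card §Stubs): (a) seed table = PS19
knots with `s_ℚ ≠ 0` and `τ = ν = ε = 0` (≈ 78 by DG p. 35), minus those an HKL test obstructs from
topological sliceness (DG Thm 3.1), minus `d(Σ₂) ≠ 0` / `d(S³_{±1}) ≠ 0`, minus `0`-surgery-rigid
genus-1 seeds (Baldwin–Sivek: `Wh±(T₂,₃,2)` is `0`-characterised — the textbook `τ = 0, s = 2` knot is
DEAD as a seed); (b) per surviving seed, `0`-friends by DG drilling with geodesic length ≤ 6–8 (DG used
≤ 3), all hyperbolically plausible `S³` fillings, plus RBG links with knotted `R` and annulus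
presentations; post-filter away pairs with a super-special RBG presentation (DG Thm 5.9 forces
`s = 0` there); (c) band search (DG §2) on every friend. Why plausibly true: nothing is known to
force `s = 0` on partners outside the Gluck / (super-)special-RBG families (MMSW Q 9.11 open;
arXiv:2601.05425 p. 24), and the seed side of this sector has never been searched at depth > 3. Why
it might fail: `𝔇 ∩ PS19` may be EMPTY after the filters (then `not_certifiedPairSupply_of_sieve`
kills this stub from seed-side data alone), or every friend of every seed is non-slice (SPC4 /
kill switch 0368). Toroidal-`0`-surgery seeds (satellites, Whitehead doubles) are invisible to
drilling and belong to line `genus-one-witness-first` (triage r1-2 sharpening); RBG-family seeds to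
`lz-transport-theta-window`. Honours Disproof §1 (all conjuncts produced), §2 (friend ≠ seed: the
certificate pair is never isotopic in a live instance, cf. the kill form).
[cite: arXiv:2512.21825, pp. 34–37, §5.1] [cite: arXiv:2211.04280, Thm 1.1] -/
theorem stub_certifiedPairSupply :
    ∃ (K' : Knot) (D : GaussDiagram) (K : Knot),
      IsCertifiedSeed K' D ∧ HasFusionCertificate K ∧ HasZeroFriendCertificate K K' := by
  sorry

/-- **STUB 2 — the `0`-friend certificate is sound (Kirby's theorem, "if" direction; M,
theorem-level modulo ONE named fact).** If `(K, 0)` and `(K', 0)` are strictly Kirby equivalent, some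
closed smooth 3-manifold `Y` is `0`-surgery on both. Proof route in the tree: `Y :=` the model
`0`-surgery on `K` (`exists_isIntegralSurgery_holds`), `Y' :=` that on `K'`; `Y ≃ₘ Y'` by
`StrictKirbyEquivalent.nonempty_diffeomorph_of_isSurgery` (PROVED modulo the single open leaf (H)
`FramedLink.IsStrictHandleSlide.isSurgery` — a strict handle slide does not change the surgered
manifold, Kirby 1989 Ch. I §5 Thm 5.1 move (1); existence/uniqueness/isotopy/reversal/blow-down leaves
are all discharged) with `FramedLink.isSurgery_single_iff`; transport `K'`'s surgery structure from
`Y'` to `Y` along the diffeomorphism (`IsIntegralSurgery.of_diffeomorph` with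
`IsOpenGluing.of_diffeomorph_holds_self`, proved). Why it might fail: only if the tree's
`IsStrictHandleSlide` were still mis-stated (the permissive `IsHandleSlide` was: collar-crossing
bands, `KirbyMovesSurgery.lean` §Erratum) — then reshape to the corrected relation; the mathematics
(Kirby 1978 Thm 1 "if") is a theorem. [cite: Kirby1978, Thm 1] [cite: Kirby1989, Ch. I §5 Thm 5.1] -/
theorem stub_commonZeroSurgery_of_zeroFriendCertificate :
    ∀ (K K' : Knot), HasZeroFriendCertificate K K' →
      ∃ (Y : Type) (_ : TopologicalSpace Y) (_ : T2Space Y) (_ : SecondCountableTopology Y)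
        (_ : ChartedSpace (𝔼 3) Y) (_ : IsManifold (𝓡 3) ∞ Y) (_ : CompactSpace Y),
        IsIntegralSurgery (𝓡 3) Y K 0 ∧ IsIntegralSurgery (𝓡 3) Y K' 0 := by
  sorry

/-- **STUB 3 — the ribbon certificate is sound (L; classical).** A fusion of a split unlink along
finitely many bands is ribbon in the tree's sense (`Knot.IsRibbon`: bounds a smooth slice disc on
which `‖·‖²` is Morse with no interior local maximum): push the `n + 1` spanning discs of the unlink
into `B⁴` to different depths (one non-degenerate minimum each) and realise each band as one
non-degenerate saddle; induct along `IsFusionOf`, the step being "ribbon disc for `L₀` and a disc for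
the untouched unknot `L_{k+1}` (split from the rest) + one saddle". Kauffman: "a knot is ribbon iff it
has a movie with saddle points and minima, but no maxima"; Dunfield–Gong: "when a knot has a sequence
of `k` band moves resulting in an unlink, it is ribbon". Why it might fail: it cannot mathematically;
the Lean cost is the explicit smooth model of a saddle band and the Morse bookkeeping (cf. the tree's
`isRibbonDisc_unknot_flatDisc`). Sources: GompfStipsicz1999 §6.2; Kauffman, On Knots (1987) Ch. V
pp. 70–74 and Ex. 5.12; arXiv:2512.21825 §2 p. 15. [cite: GompfStipsicz1999, §6.2] -/
theorem stub_isRibbon_of_fusionCertificate :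
    ∀ K : Knot, HasFusionCertificate K → K.IsRibbon := by
  sorry

/-- **STUB 4 — profile clause "`g(K') = g(K)`" (Gabai 1987: `0`-surgery detects the Seifert genus;
L, theorem-level modulo a named fact).** If a closed smooth 3-manifold `Y` is `0`-surgery on `K` and on
`K'`, then `K.genus = K'.genus`. Route: the capped-off minimal-genus Seifert surface of `K` is a
non-separating closed surface of genus `g(K)` in `Y` (construction; the "≥ half" explicitly NOT
vendored with the tree's fact), so Gabai's Cor. 8.3 (tree named fact
`hasSeifertSurfaceOfGenus_le_of_isIntegralSurgery_zero`, applied to `K'` and `Y`) gives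
`g(K') ≤ g(K)`; symmetrically `g(K) ≤ g(K')`. Role in the line: the seed sieve may restrict friend
generation and `0`-surgery-rigidity tests to knots of the seed's genus (third filter of the kill
form; Baldwin–Sivek's genus-1 characterisations). Why it might fail: it cannot for the statement
(Gabai); formally the unknot case is Property R (`g = 0`, `Y = S¹ × S²`), covered by the same fact.
[cite: GabaiJDG1987, Cor. 8.3] [cite: arXiv:2211.04280, Thm 1.1] -/
theorem stub_genus_eq_of_commonZeroSurgery :
    ∀ (K K' : Knot) (Y : Type) [TopologicalSpace Y] [T2Space Y] [SecondCountableTopology Y]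
      [ChartedSpace (𝔼 3) Y] [IsManifold (𝓡 3) ∞ Y] [CompactSpace Y],
      IsIntegralSurgery (𝓡 3) Y K 0 → IsIntegralSurgery (𝓡 3) Y K' 0 → K.genus = K'.genus := by
  sorry

/-- **STUB 5 — profile clause "`K'` topologically slice" (Freedman; XL in Lean, theorem-level).**
A knot bounding a smooth proper disc in `Σ ∖ B̊⁴`, `Σ` a closed smooth homotopy 4-sphere
(`Knot.IsHomotopyBallSlice`), is topologically slice (`Knot.IsTopologicallySlice`: a flat disc with a
product neighbourhood in `B⁴`): the homotopy ball `W = Σ ∖ B̊⁴` is HOMEOMORPHIC to `B⁴` (Freedman 1982,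
Thm 1.6; the boundary identification is corrected by coning, Alexander trick), and the smooth disc's
tubular neighbourhood `D² × ℝ²` (made neat by pushing the collar) is carried to the required flat
product neighbourhood. Exactly the step "every homotopy 4-ball is topologically standard [FQ], it
follows that `K'` is topologically slice" of Dunfield–Gong's Thm 5.14. It is the disprover's hypothesis
`hF` (Disproof §8) turned into a target, and the reason every TOPOLOGICAL sliceness obstruction (HKL /
Casson–Gordon, signatures, Fox–Milnor) is a valid SEED FILTER. Why it might fail: it cannot
mathematically; formally it needs Freedman's disc theorem as a vendored cite fact
(`Literature/Topology/FourManifolds/HomotopyS4Freedman.lean` territory) plus topological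
tubular-neighbourhood bookkeeping. [cite: Freedman1982, Thm. 1.6] [cite: arXiv:2512.21825, Thm 5.14 p. 47] -/
theorem stub_isTopologicallySlice_of_isHomotopyBallSlice :
    ∀ K : Knot, K.IsHomotopyBallSlice → K.IsTopologicallySlice := by
  sorry

/-! ### Composition: the Transfer `C⁺ → Crux` and the crux BY NAME (kernel-checked; no `sorry` of their own) -/

/-- **TRANSFER `C⁺ → Crux` (stubs 2–3).** A certified pair yields a crux witness: stub 2 turns the
`0`-friend certificate into a common `0`-surgery `Y`; stub 3 turns the band certificate into a ribbon
disc, hence a slice disc (`Knot.IsRibbon.isSmoothlySlice`, proved); the seed certificate gives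
`K'.HasRasmussenInvariant (D.rasmussenInvariant)` by definition (`K'` is its own isotopic
representative) with `D.rasmussenInvariant ≠ 0`. [cite: ManolescuPiccirillo2023, §1 p. 1] -/
theorem crux_of_certifiedPair
    (h : ∃ (K' : Knot) (D : GaussDiagram) (K : Knot),
      IsCertifiedSeed K' D ∧ HasFusionCertificate K ∧ HasZeroFriendCertificate K K') : Crux := by
  obtain ⟨K', D, K, ⟨hD, -, hs0⟩, hF, hZ⟩ := h
  obtain ⟨Y, _, _, _, _, _, _, hK, hK'⟩ := stub_commonZeroSurgery_of_zeroFriendCertificate K K' hZ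
  exact ⟨K, K', Y, _, _, D.rasmussenInvariant, hK, hK',
    (stub_isRibbon_of_fusionCertificate K hF).isSmoothlySlice,
    ⟨K', D, SphereEmbedding.IsIsotopic.refl _, hD, rfl⟩, hs0⟩

/-- **`ZseCruxRasmussen` (as `Literature.Uncategorized.Crux`, the ledger signature verbatim) from
stubs 1–3**: the bet (stub 1) fed through the Transfer. The audit's `closed` flag on this declaration
turns true exactly when stubs 1–3 are sorry-free. -/
theorem ZseCruxRasmussen_of : Crux :=
  crux_of_certifiedPair stub_certifiedPairSupply

/-! ### The forced profile: sieve soundness and the kill form of the bet (checked, no `sorry`) -/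

/-- Certified `0`-friends have the same Seifert genus (stubs 2 + 4). [cite: GabaiJDG1987, Cor. 8.3] -/
theorem genus_eq_of_zeroFriendCertificate (K K' : Knot) (hZ : HasZeroFriendCertificate K K') :
    K.genus = K'.genus := by
  obtain ⟨Y, _, _, _, _, _, _, hK, hK'⟩ := stub_commonZeroSurgery_of_zeroFriendCertificate K K' hZ
  exact stub_genus_eq_of_commonZeroSurgery K K' Y hK hK'

/-- **The forced profile of a seed.** If `K` carries a band certificate and `(K, K')` a `0`-friend
certificate, then `K'` is slice in a homotopy 4-ball (Manolescu–Piccirillo Lemma 3.3, PROVED: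
`isHomotopyBallSlice_of_zeroSurgeryPair`), topologically slice (stub 5) and has the Seifert genus of
`K` (stub 4). The informal clauses `τ = ν = ε = 0`, `Υ ≡ 0`, `d(Σ₂(K')) = 0` follow from the first
(homology-concordance invariance, Hom–Levine–Lidman §4) but have no home in the tree yet.
[cite: ManolescuPiccirillo2023, Lemma 3.3] [cite: arXiv:1801.07770, §4] -/
theorem seed_profile (K K' : Knot) (hF : HasFusionCertificate K)
    (hZ : HasZeroFriendCertificate K K') :
    K'.IsHomotopyBallSlice ∧ K'.IsTopologicallySlice ∧ K'.genus = K.genus := by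
  obtain ⟨Y, _, _, _, _, _, _, hK, hK'⟩ := stub_commonZeroSurgery_of_zeroFriendCertificate K K' hZ
  have hsl : K.IsSmoothlySlice := (stub_isRibbon_of_fusionCertificate K hF).isSmoothlySlice
  have hH : K'.IsHomotopyBallSlice := isHomotopyBallSlice_of_zeroSurgeryPair hK hK' hsl
  exact ⟨hH, stub_isTopologicallySlice_of_isHomotopyBallSlice K' hH,
    (stub_genus_eq_of_commonZeroSurgery K K' Y hK hK').symm⟩

/-- **KILL FORM OF THE BET — the three typed seed filters are sound** (mod Rasmussen's Theorem 1,
the tree's named fact `eq_zero_of_isSmoothlySlice`). If every certified seed `K'` is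
(i) NOT topologically slice (what an HKL / Casson–Gordon test certifies), or
(ii) NOT slice in any homotopy 4-ball (what `τ`, `ν`, `ε`, `Υ`, `d`-invariants certify — informal
here), or
(iii) `0`-SURGERY-RIGID among knots of its own genus (every certified `0`-friend of the same genus is
isotopic to it — Baldwin–Sivek-type characterisations; Gabai's stub 4 makes the genus restriction
free), then STUB 1 is false: no certified pair exists in the sector. Case (iii): the ribbon friend is
then isotopic to the seed, which becomes ribbon (`Knot.IsRibbon.of_isIsotopic_holds`, proved), hence
slice, hence `s = 0` (Rasmussen) — Disproof §2 `crux_false_of_sameKnot` at certificate level.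
[cite: Rasmussen2010, Thm. 1] [cite: arXiv:2211.04280, Thm 1.1] -/
theorem not_certifiedPairSupply_of_sieve (hR : eq_zero_of_isSmoothlySlice)
    (h : ∀ (K' : Knot) (D : GaussDiagram), IsCertifiedSeed K' D →
      ¬ K'.IsTopologicallySlice ∨ ¬ K'.IsHomotopyBallSlice ∨
        ∀ K : Knot, K.genus = K'.genus → HasZeroFriendCertificate K K' → K.IsIsotopic K') :
    ¬ ∃ (K' : Knot) (D : GaussDiagram) (K : Knot),
      IsCertifiedSeed K' D ∧ HasFusionCertificate K ∧ HasZeroFriendCertificate K K' := by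
  rintro ⟨K', D, K, hseed, hF, hZ⟩
  obtain ⟨hD, hn, hs0⟩ := hseed
  obtain ⟨hH, hT, hg⟩ := seed_profile K K' hF hZ
  have hrib : K.IsRibbon := stub_isRibbon_of_fusionCertificate K hF
  rcases h K' D ⟨hD, hn, hs0⟩ with hnt | hnh | hrig
  · exact hnt hT
  · exact hnh hH
  · have hiso : K.IsIsotopic K' := hrig K hg.symm hZ
    have hrib' : K'.IsRibbon := Knot.IsRibbon.of_isIsotopic_holds hiso hrib
    have hs : K'.HasRasmussenInvariant D.rasmussenInvariant :=
      ⟨K', D, SphereEmbedding.IsIsotopic.refl _, hD, rfl⟩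
    exact hs0 (hR hs hrib'.isSmoothlySlice)

/-! ### Checks against the landed Negative lemmas; the exact price of the bet (no `sorry` of their own) -/

section Checks

open Summit.SmoothPoincare4.SmoothPoincare4.Theorems.ZseCruxRasmussen

/-- PARITY (landed `Negative.hasRasmussenInvariant_even`, Rasmussen Prop. 3.3): a certified seed has
`2 ≤ |s|`, so the seed table may demand `|s_ℚ| ≥ 2` outright (cf. `Negative.crux_iff_two_le_abs`).
[cite: Rasmussen2010, Prop. 3.3] -/
theorem two_le_abs_of_isCertifiedSeed {K' : Knot} {D : GaussDiagram} (h : IsCertifiedSeed K' D) :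
    2 ≤ |D.rasmussenInvariant| := by
  obtain ⟨hD, -, hs0⟩ := h
  have hs : K'.HasRasmussenInvariant D.rasmussenInvariant :=
    ⟨K', D, SphereEmbedding.IsIsotopic.refl _, hD, rfl⟩
  obtain ⟨t, ht⟩ := Negative.hasRasmussenInvariant_even hs
  have ht0 : t ≠ 0 := by
    rintro rfl
    exact hs0 (by simpa using ht)
  rw [ht, ← two_mul, abs_mul, abs_two]
  have : 1 ≤ |t| := Int.one_le_abs ht0
  linarith

/-- SLICE-PARTNER exclusion at certificate level (landed `Negative.crux_false_of_slicePartner`, mod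
Rasmussen's Theorem 1): a certified seed is not smoothly slice. [cite: Rasmussen2010, Thm. 1] -/
theorem seed_not_isSmoothlySlice (hR : eq_zero_of_isSmoothlySlice) {K' : Knot} {D : GaussDiagram}
    (h : IsCertifiedSeed K' D) : ¬ K'.IsSmoothlySlice := fun hsl =>
  h.2.2 (hR ⟨K', D, SphereEmbedding.IsIsotopic.refl _, h.1, rfl⟩ hsl)

/-- SAME-KNOT exclusion at certificate level (landed `Negative.crux_false_of_sameKnot`, mod Rasmussen's
Theorem 1; uses stub 3): the band-certified friend is never the seed — seeds are not ribbon, so friend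
generation may skip the seed's own isotopy class (filter (iii) of the kill form is the genus-wide form).
[cite: Rasmussen2010, Thm. 1] -/
theorem friend_ne_seed (hR : eq_zero_of_isSmoothlySlice) {K' : Knot} {D : GaussDiagram} {K : Knot}
    (h : IsCertifiedSeed K' D) (hF : HasFusionCertificate K) : K ≠ K' := by
  rintro rfl
  exact seed_not_isSmoothlySlice hR h (stub_isRibbon_of_fusionCertificate K hF).isSmoothlySlice

/-- CONCORDANCE exclusion at certificate level (landed `Negative.crux_false_of_concordant`, mod Rasmussen;
Fox–Milnor in the tree: `Knot.IsConcordant.isSmoothlySlice`): the seed is never concordant to its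
band-certified friend — certified pairs are NON-CONCORDANT `0`-friends, so the `0`-surgery homeomorphism
behind a `0`-friend certificate never extends to a concordance of traces. [cite: FoxMilnor1966, §1] -/
theorem not_isConcordant_seed_friend (hR : eq_zero_of_isSmoothlySlice) {K' : Knot} {D : GaussDiagram}
    {K : Knot} (h : IsCertifiedSeed K' D) (hF : HasFusionCertificate K) : ¬ K'.IsConcordant K :=
  fun hc => seed_not_isSmoothlySlice hR h
    (hc.isSmoothlySlice (stub_isRibbon_of_fusionCertificate K hF).isSmoothlySlice)

/-- **THE EXACT PRICE OF THE BET, I** (landed `Negative.not_crux_of_spc4` through the Transfer): under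
`SmoothPoincare4` and Rasmussen's Theorem 1 no certified pair exists — a positive instance of stub 1 is
a DISPROOF of SPC4 (and, Disproof §7, a `ℂℙ²`-stably exotic homotopy sphere). Nothing cheaper than the
seed-side kill form `not_certifiedPairSupply_of_sieve` can refute stub 1.
[cite: ManolescuPiccirillo2023, §1 p. 1] [cite: FreedmanGompfMorrisonWalker2010, §1] -/
theorem not_certifiedPair_of_spc4 (hR : eq_zero_of_isSmoothlySlice) (hS : _root_.SmoothPoincare4) :
    ¬ ∃ (K' : Knot) (D : GaussDiagram) (K : Knot),
      IsCertifiedSeed K' D ∧ HasFusionCertificate K ∧ HasZeroFriendCertificate K K' :=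
  fun h => by
    -- = landed `Negative.not_crux_of_spc4 hR hS (crux_of_certifiedPair h)`; inlined while the farm has
    -- not yet built `Theorems/ZseCruxRasmussen/Negative/Shape.lean` (p76009, landed 2026-08-16T02:30Z)
    obtain ⟨K, K', Y, _, _, s, hK, hK', hsl, hs, hs0⟩ := crux_of_certifiedPair h
    refine hs0 (hR hs ?_)
    by_contra hns
    obtain ⟨M, _, _, _, i₄, i₅, _, ⟨e⟩, hE⟩ :=
      Knot.exists_exotic_of_isHomotopyBallSlice_not_isSmoothlySlice_holds
        ⟨K', isHomotopyBallSlice_of_zeroSurgeryPair hK hK' hsl, hns⟩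
    obtain ⟨d⟩ := hS M i₄ i₅ e
    exact hE.false d

/-- **THE EXACT PRICE OF THE BET, II** (landed `Negative.not_crux_of_mmsw911` through the Transfer): a
positive answer to MMSW Question 9.11 (knots slice in homotopy balls have `s = 0`; OPEN, registered
`Literature.Barriers.SmoothPoincare4.MMSW2023Question911Knot`) kills stub 1 — the quarterly literature
falsifier of the route header. [cite: ManolescuMarengonSarkarWillis2023, Question 9.11] -/
theorem not_certifiedPair_of_mmsw911 (hq : Literature.Barriers.SmoothPoincare4.MMSW2023Question911Knot) :
    ¬ ∃ (K' : Knot) (D : GaussDiagram) (K : Knot),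
      IsCertifiedSeed K' D ∧ HasFusionCertificate K ∧ HasZeroFriendCertificate K K' :=
  fun h =>
    -- = landed `Negative.not_crux_of_mmsw911 hq (crux_of_certifiedPair h)` (Shape.lean olean pending)
    (not_crux_iff_sVanishesOnPairs.2 (sVanishesOnPairs_of_mmsw2023Question911Knot hq))
      (crux_of_certifiedPair h)

end Checks

/-- Wiring check: the waypoint one level up (`FGMWRasmussenStrategy`, registered OPEN in the barrier
catalogue) follows from the same three stubs through the PROVED `fgmwRasmussenStrategy_of_crux`. -/
example : Literature.Barriers.SmoothPoincare4.FGMWRasmussenStrategy :=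
  fgmwRasmussenStrategy_of_crux ZseCruxRasmussen_of

end Summit.SmoothPoincare4.SmoothPoincare4.Cruxes.ZseCruxRasmussen.ForcedProfileInversion

end
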